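import Mathlib
import Summits.HodgeConjecture.HodgeConjecture.Theorems.HodgeLocusCensusUnitColumnRankLevelsPowers
import Summits.HodgeConjecture.HodgeConjecture.Theorems.HodgeLocusCensusUnitColumnRankD3Deficit

/-!
# Hodge locus census — THEOREM L beyond characteristic 0 (the unit column of every power at every level, over an arbitrary field)

Certified instances and evidence bearing on the general Hodge conjecture; no claim.

Anchor 229 (`…UnitColumnRankLevelsPowers.rank_mulDeltaPow_levels`) computes, for `char K = 0`, the rank of
`×q^c : B_{k(e+1)−j−c(e+1)} → B_{k(e+1)−j}` (`B = K[x₁,…,x_k]/(xᵢ^{e+2})`, `q = Σ xᵢ^{e+1}`, `d = e + 3 ≥ 3`) as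
`Σ_μ [e+1 ∣ σ ∧ (e+1)s ≤ σ] · min (C(k−s,t), C(k−s,t+c))` (`σ = j + Σμ`, `s = #{μ ≠ 0}`, `t = σ/(e+1) − s`).  This file records what
survives over an ARBITRARY field `K`, for the same matrix:

* (LW) `rank = Σ_μ [feasible] · rank_K (c! • W_{t,t+c}({x // μ x = 0}))` — the label blocks are `c!` times set-inclusion matrices over any field
  (`rank_mulDeltaPow_levels_eq_sum`);
* (L≤) `rank ≤` THEOREM L's value (`rank_mulDeltaPow_levels_le`);
* (L0) `(c! : K) = 0` (e.g. `char K = p ≤ c`) ⇒ the matrix is `0` (`mulDeltaPow_levels_eq_zero`, `rank_mulDeltaPow_levels_eq_zero_of_charP`);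
* (W2) `(2 : K) = 0`, `α` nonempty ⇒ `rank_K W_{t,t+1}(α) = C(|α| − 1, t)` (`rank_incl_one_of_two_eq_zero`; lower bound `C(|α|−1,t) ≤ rank` over
  any field, upper bound by the `C(|α|−1,t−1)` left-kernel vectors `Σ_{T ⊇ S} e_T`);
* (L2) `(2 : K) = 0`, `c = 1` (anchor 222's indicator matrix) ⇒ `rank = Σ_μ [feasible ∧ s < k] · C(k−s−1, t)` (`rank_mulDelta_levels_of_two_eq_zero`),
  which contains anchors `…D3Deficit` (N2) and `…D4Deficit` (M1) as the cases `(d, j) = (3, 2), (4, 2)`.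

So the characteristic-2 column of the positive-characteristic exceptions table is a theorem for every `d`, `c`, level (`c = 0` the identity,
`c = 1` (L2), `c ≥ 2` zero by (L0)); for odd `p` the table is reduced by (LW) to the modular ranks of set-inclusion matrices (Wilson 1990), bounded by (L≤),
and zero for `p ≤ c` by (L0).  Imports `Mathlib` + anchors 174 / 219 / 222 / 229 / `…D3Deficit` BY NAME; nothing restated; theorem-only,
definition-free, `sorry`-free, no `decide`.
-/

set_option linter.dupNamespace false
set_option autoImplicit false

namespace Summit.HodgeConjecture.HodgeConjecture.HodgeLocus.Census.UnitColumnRankLevelsChar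

open Summit.HodgeConjecture.HodgeConjecture.HodgeLocus.Census.ModelNonJumpC1All (colR)
open Summit.HodgeConjecture.HodgeConjecture.HodgeLocus.Census.UnitColumnRankD4 (indicator_eq_count_colR)
open Summit.HodgeConjecture.HodgeConjecture.HodgeLocus.Census.UnitColumnRankD4Levels (rank_eq_sum_rank_fiber_of)
open Summit.HodgeConjecture.HodgeConjecture.HodgeLocus.Census.UnitColumnRankLevels (exists_fiberEquiv)
open Summit.HodgeConjecture.HodgeConjecture.HodgeLocus.Census.UnitColumnRankLevelsPowers (count_iterate_colR rank_fiber_pow_zero)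
open Summit.HodgeConjecture.HodgeConjecture.HodgeLocus.Census.UnitColumnRankD3Deficit (rank_add_card_le_of_vecMul_eq_zero
  linearIndependent_of_apply_ne_zero)
open Matrix Module

/-! ## The set-inclusion matrix `W_{t,t+1}(α)` over an arbitrary field and in characteristic 2 -/

section Incl

variable (K : Type*) [Field K] {α : Type*} [Fintype α] [DecidableEq α]

/-- LOWER BOUND over any field: the rows `T ∌ z` against the columns `T ∪ {z}` carry an identity matrix of size `C(|α| − 1, t)`. -/
theorem choose_le_rank_incl_one (z : α) (t : ℕ) :
    (Fintype.card α - 1).choose t ≤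
      (Matrix.of fun (T : {S : Finset α // S.card = t}) (U : {S : Finset α // S.card = t + 1}) => if T.1 ⊆ U.1 then (1 : K) else 0).rank := by
  have hz : ∀ S : Finset {x : α // x ≠ z}, z ∉ S.map (Function.Embedding.subtype _) := fun S h => by
    obtain ⟨x, -, hx⟩ := Finset.mem_map.mp h
    exact x.2 hx
  have hι : Fintype.card {S : Finset {x : α // x ≠ z} // S.card = t} = (Fintype.card α - 1).choose t := by
    rw [Fintype.card_finset_len, Fintype.card_subtype_compl, Fintype.card_subtype_eq]
  have hsub : (Matrix.of fun (T : {S : Finset α // S.card = t}) (U : {S : Finset α // S.card = t + 1}) => if T.1 ⊆ U.1 then (1 : K) else 0).submatrix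
      (fun (S : {S : Finset {x : α // x ≠ z} // S.card = t}) =>
        (⟨S.1.map (Function.Embedding.subtype _), by rw [Finset.card_map, S.2]⟩ : {S : Finset α // S.card = t}))
      (fun (S : {S : Finset {x : α // x ≠ z} // S.card = t}) =>
        (⟨insert z (S.1.map (Function.Embedding.subtype _)), by rw [Finset.card_insert_of_notMem (hz S.1), Finset.card_map, S.2]⟩ :
          {S : Finset α // S.card = t + 1})) = 1 := by
    ext S S'
    rw [Matrix.submatrix_apply, Matrix.of_apply, Matrix.one_apply]
    refine if_congr ⟨fun h => ?_, fun h => h ▸ Finset.subset_insert _ _⟩ rfl rfl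
    exact Subtype.ext (Finset.eq_of_subset_of_card_le
      (Finset.map_subset_map.mp ((Finset.subset_insert_iff_of_notMem (hz S.1)).mp h)) (by rw [S.2, S'.2]))
  calc (Fintype.card α - 1).choose t = Fintype.card {S : Finset {x : α // x ≠ z} // S.card = t} := hι.symm
    _ = ((Matrix.of fun (T : {S : Finset α // S.card = t}) (U : {S : Finset α // S.card = t + 1}) => if T.1 ⊆ U.1 then (1 : K) else 0).submatrix
      (fun (S : {S : Finset {x : α // x ≠ z} // S.card = t}) =>
        (⟨S.1.map (Function.Embedding.subtype _), by rw [Finset.card_map, S.2]⟩ : {S : Finset α // S.card = t}))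
      (fun (S : {S : Finset {x : α // x ≠ z} // S.card = t}) =>
        (⟨insert z (S.1.map (Function.Embedding.subtype _)), by rw [Finset.card_insert_of_notMem (hz S.1), Finset.card_map, S.2]⟩ :
          {S : Finset α // S.card = t + 1}))).rank := by rw [hsub, Matrix.rank_one]
    _ ≤ _ := Matrix.rank_submatrix_le _ _ _

/-- CHAINS THROUGH A `t`-SET over any field: `Σ_{|T| = t+1} [S ⊆ T ⊆ U] = [S ⊆ U] · |U ∖ S|` for `|S| = t`. -/
theorem sum_ite_subset_subset (S U : Finset α) (t : ℕ) (hS : S.card = t) :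
    (∑ T : {T : Finset α // T.card = t + 1}, if S ⊆ T.1 ∧ T.1 ⊆ U then (1 : K) else 0) = if S ⊆ U then ((U \ S).card : K) else 0 := by
  rw [Finset.sum_boole]
  by_cases hSU : S ⊆ U
  · rw [if_pos hSU]
    refine congrArg Nat.cast (Finset.card_bij
      (fun a ha => (⟨insert a S, by rw [Finset.card_insert_of_notMem (Finset.mem_sdiff.mp ha).2, hS]⟩ : {T : Finset α // T.card = t + 1}))
      (fun a ha => ?_) (fun a₁ ha₁ a₂ ha₂ h => ?_) (fun T hT => ?_)).symm
    · obtain ⟨haU, -⟩ := Finset.mem_sdiff.mp ha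
      exact Finset.mem_filter.mpr ⟨Finset.mem_univ _, Finset.subset_insert a S, Finset.insert_subset haU hSU⟩
    · have h' : insert a₁ S = insert a₂ S := congrArg Subtype.val h
      have ha : a₁ ∈ insert a₂ S := by rw [← h']; exact Finset.mem_insert_self a₁ S
      rcases Finset.mem_insert.mp ha with h'' | h''
      · exact h''
      · exact absurd h'' (Finset.mem_sdiff.mp ha₁).2
    · obtain ⟨hST, hTU⟩ := (Finset.mem_filter.mp hT).2
      have hcard : (T.1 \ S).card = 1 := by rw [Finset.card_sdiff_of_subset hST, T.2, hS]; omega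
      obtain ⟨a, ha⟩ := Finset.card_eq_one.mp hcard
      have haT : a ∈ T.1 \ S := by rw [ha]; exact Finset.mem_singleton_self a
      refine ⟨a, Finset.mem_sdiff.mpr ⟨hTU (Finset.mem_sdiff.mp haT).1, (Finset.mem_sdiff.mp haT).2⟩, Subtype.ext ?_⟩
      show insert a S = T.1
      rw [Finset.insert_eq, ← ha, Finset.sdiff_union_of_subset hST]
  · rw [if_neg hSU, Finset.filter_eq_empty_iff.mpr (fun T _ h => hSU (h.1.trans h.2)), Finset.card_empty, Nat.cast_zero]

/-- CHARACTERISTIC 2, UPPER BOUND: the `C(|α|−1, t)` vectors `y_S = Σ_{T ⊇ S} e_T` (`S` a `t`-set avoiding `z`) lie in the left kernel of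
`W_{t+1,t+2}(α)` (`(y_S · W)_U = [S ⊆ U] · |U ∖ S| = 2 [S ⊆ U] = 0`) and are independent (private coordinate `S ∪ {z}`). -/
theorem rank_incl_one_add_choose_le (h2 : (2 : K) = 0) (z : α) (t : ℕ) :
    (Matrix.of fun (T : {S : Finset α // S.card = t + 1}) (U : {S : Finset α // S.card = t + 1 + 1}) => if T.1 ⊆ U.1 then (1 : K) else 0).rank +
      (Fintype.card α - 1).choose t ≤ (Fintype.card α).choose (t + 1) := by
  have hz : ∀ S : Finset {x : α // x ≠ z}, z ∉ S.map (Function.Embedding.subtype _) := fun S h => by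
    obtain ⟨x, -, hx⟩ := Finset.mem_map.mp h
    exact x.2 hx
  have hι : Fintype.card {S : Finset {x : α // x ≠ z} // S.card = t} = (Fintype.card α - 1).choose t := by
    rw [Fintype.card_finset_len, Fintype.card_subtype_compl, Fintype.card_subtype_eq]
  rw [← hι, ← Fintype.card_finset_len (α := α) (t + 1)]
  refine rank_add_card_le_of_vecMul_eq_zero _
    (fun (S : {S : Finset {x : α // x ≠ z} // S.card = t}) (T : {S : Finset α // S.card = t + 1}) =>
      if S.1.map (Function.Embedding.subtype _) ⊆ T.1 then (1 : K) else 0) ?_ (fun S => ?_)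
  · refine linearIndependent_of_apply_ne_zero _
      (fun S => ⟨insert z (S.1.map (Function.Embedding.subtype _)), by rw [Finset.card_insert_of_notMem (hz S.1), Finset.card_map, S.2]⟩)
      (fun S => ?_) (fun S S' hne => ?_)
    · simp only
      rw [if_pos (Finset.subset_insert _ _)]
      exact one_ne_zero
    · simp only
      rw [if_neg]
      intro hsub
      exact hne (Subtype.ext (Finset.eq_of_subset_of_card_le
        (Finset.map_subset_map.mp ((Finset.subset_insert_iff_of_notMem (hz S'.1)).mp hsub)) (by rw [S.2, S'.2])))
  · funext U
    rw [Pi.zero_apply]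
    show (∑ T : {S : Finset α // S.card = t + 1}, (if S.1.map (Function.Embedding.subtype _) ⊆ T.1 then (1 : K) else 0) *
      (if T.1 ⊆ U.1 then (1 : K) else 0)) = 0
    simp_rw [ite_mul, one_mul, zero_mul, ← ite_and]
    rw [sum_ite_subset_subset K _ U.1 t (by rw [Finset.card_map, S.2])]
    split_ifs with h
    · rw [Finset.card_sdiff_of_subset h, U.2, Finset.card_map, S.2, show t + 1 + 1 - t = 2 by omega, Nat.cast_ofNat, h2]
    · rfl

/-- CHARACTERISTIC 2: `rank_K W_{t,t+1}(α) = C(|α| − 1, t)` for nonempty `α` (`(2 : K) = 0`); over `ℚ` it is `min (C(|α|,t), C(|α|,t+1))`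
(anchor 204). -/
theorem rank_incl_one_of_two_eq_zero (h2 : (2 : K) = 0) [Nonempty α] (t : ℕ) :
    (Matrix.of fun (T : {S : Finset α // S.card = t}) (U : {S : Finset α // S.card = t + 1}) => if T.1 ⊆ U.1 then (1 : K) else 0).rank =
      (Fintype.card α - 1).choose t := by
  obtain ⟨z⟩ := (inferInstance : Nonempty α)
  refine le_antisymm ?_ (choose_le_rank_incl_one K z t)
  cases t with
  | zero =>
    refine (Matrix.rank_le_card_height _).trans ?_
    rw [Fintype.card_finset_len, Nat.choose_zero_right, Nat.choose_zero_right]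
  | succ t =>
    have h := rank_incl_one_add_choose_le K h2 z t
    obtain ⟨n, hn⟩ : ∃ n, Fintype.card α = n + 1 := ⟨_, (Nat.sub_add_cancel Fintype.card_pos).symm⟩
    rw [hn, Nat.choose_succ_succ', Nat.add_sub_cancel] at h
    rw [hn, Nat.add_sub_cancel]
    omega

end Incl

/-! ## The label blocks over an arbitrary field -/

/-- THE BLOCK OF A FEASIBLE LABEL `μ` (`j + Σμ = (e+1)(t + s)`) over ANY field: its rank is that of `c! • W_{t,t+c}({x // μ x = 0})`
(anchor 222's `exists_fiberEquiv` and anchor 229's multiplicity identity `count_iterate_colR`; anchor 229's `rank_fiber_pow` is the case `char K = 0`). -/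
theorem rank_fiber_pow_eq (K : Type*) [Field K] (k e c j : ℕ) (μ : Fin k → Fin (e + 1)) (t : ℕ)
    (hj : j + ∑ i, (μ i : ℕ) = (e + 1) * (t + (Finset.univ.filter (fun l => (μ l : ℕ) ≠ 0)).card)) :
    (Matrix.of fun (r : {r : {v : Fin k → Fin (e + 2) // (∑ i, (v i : ℕ)) + j = k * (e + 1)} // ∀ l, (r.1 l : ℕ) % (e + 1) = (μ l : ℕ)})
        (q : {q : {m : Fin k → Fin (e + 2) // (∑ i, (m i : ℕ)) + (j + c * (e + 1)) = k * (e + 1)} //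
          ∀ l, (q.1 l : ℕ) % (e + 1) = (μ l : ℕ)}) =>
      ((((List.flatMap (colR (e + 3)))^[c] [List.ofFn (fun i => (q.1.1 i : ℕ))]).count (List.ofFn (fun i => (r.1.1 i : ℕ))) : ℕ) : K)).rank =
      ((((c.factorial : ℕ) : K)) • Matrix.of fun (T : {Z : Finset {x : Fin k // (μ x : ℕ) = 0} // Z.card = t})
        (U : {Z : Finset {x : Fin k // (μ x : ℕ) = 0} // Z.card = t + c}) => if T.1 ⊆ U.1 then (1 : K) else 0).rank := by
  obtain ⟨eR, heR⟩ := exists_fiberEquiv μ j t hj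
  obtain ⟨eC, heC⟩ := exists_fiberEquiv μ (j + c * (e + 1)) (t + c)
    (by rw [show (e + 1) * (t + c + (Finset.univ.filter (fun l => (μ l : ℕ) ≠ 0)).card) =
      (e + 1) * (t + (Finset.univ.filter (fun l => (μ l : ℕ) ≠ 0)).card) + c * (e + 1) by ring]; omega)
  have key : (Matrix.of fun (r : {r : {v : Fin k → Fin (e + 2) // (∑ i, (v i : ℕ)) + j = k * (e + 1)} //
          ∀ l, (r.1 l : ℕ) % (e + 1) = (μ l : ℕ)})
        (q : {q : {m : Fin k → Fin (e + 2) // (∑ i, (m i : ℕ)) + (j + c * (e + 1)) = k * (e + 1)} //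
          ∀ l, (q.1 l : ℕ) % (e + 1) = (μ l : ℕ)}) =>
      ((((List.flatMap (colR (e + 3)))^[c] [List.ofFn (fun i => (q.1.1 i : ℕ))]).count (List.ofFn (fun i => (r.1.1 i : ℕ))) : ℕ) : K)) =
      Matrix.reindex eR.symm eC.symm (((c.factorial : ℕ) : K) • Matrix.of fun (T : {Z : Finset {x : Fin k // (μ x : ℕ) = 0} // Z.card = t})
        (U : {Z : Finset {x : Fin k // (μ x : ℕ) = 0} // Z.card = t + c}) => if T.1 ⊆ U.1 then (1 : K) else 0) := by
    ext r q
    simp only [Matrix.reindex_apply, Equiv.symm_symm, Matrix.submatrix_apply, Matrix.of_apply, Matrix.smul_apply, smul_eq_mul]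
    have hlab : ∀ l, (r.1.1 l : ℕ) % (e + 1) = (q.1.1 l : ℕ) % (e + 1) := fun l => (r.2 l).trans (q.2 l).symm
    rw [count_iterate_colR c q.1.1 r.1.1]
    by_cases hTU : (eR r).1 ⊆ (eC q).1
    · have hsub : Finset.univ.filter (fun l => (r.1.1 l : ℕ) = 0) ⊆ Finset.univ.filter (fun l => (q.1.1 l : ℕ) = 0) := by
        rw [← heR r, ← heC q]; exact Finset.map_subset_map.mpr hTU
      have hcard : (Finset.univ.filter (fun l => (q.1.1 l : ℕ) = 0)).card = (Finset.univ.filter (fun l => (r.1.1 l : ℕ) = 0)).card + c := by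
        rw [← heR r, ← heC q, Finset.card_map, Finset.card_map, (eR r).2, (eC q).2]
      rw [if_pos ⟨hlab, hsub, hcard⟩, if_pos hTU, mul_one]
    · rw [if_neg (fun h => hTU (Finset.map_subset_map.mp (by rw [heR r, heC q]; exact h.2.1))), if_neg hTU, mul_zero, Nat.cast_zero]
  rw [key, Matrix.rank_reindex]

/-- THE BLOCK OF A LABEL `μ` in the engine's fibre form (anchor 219) over ANY field: rank
`[e+1 ∣ σ ∧ (e+1)s ≤ σ] · rank (c! • W_{σ/(e+1)−s, σ/(e+1)−s+c}({x // μ x = 0}))`, `σ = j + Σμ`. -/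
theorem rank_block_pow_eq (K : Type*) [Field K] (k e c j : ℕ) (μ : Fin k → Fin (e + 1)) :
    (Matrix.of fun (r : {r : {v : Fin k → Fin (e + 2) // (∑ i, (v i : ℕ)) + j = k * (e + 1)} //
          (fun l => (⟨(r.1 l : ℕ) % (e + 1), Nat.mod_lt _ (Nat.succ_pos e)⟩ : Fin (e + 1))) = μ})
        (q : {q : {m : Fin k → Fin (e + 2) // (∑ i, (m i : ℕ)) + (j + c * (e + 1)) = k * (e + 1)} //
          (fun l => (⟨(q.1 l : ℕ) % (e + 1), Nat.mod_lt _ (Nat.succ_pos e)⟩ : Fin (e + 1))) = μ}) =>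
      ((((List.flatMap (colR (e + 3)))^[c] [List.ofFn (fun i => (q.1.1 i : ℕ))]).count (List.ofFn (fun i => (r.1.1 i : ℕ))) : ℕ) : K)).rank =
      (if (e + 1) ∣ (j + ∑ i, (μ i : ℕ)) ∧ (e + 1) * (Finset.univ.filter (fun l => (μ l : ℕ) ≠ 0)).card ≤ j + ∑ i, (μ i : ℕ) then
          ((((c.factorial : ℕ) : K)) • Matrix.of
            (fun (T : {Z : Finset {x : Fin k // (μ x : ℕ) = 0} //
                Z.card = (j + ∑ i, (μ i : ℕ)) / (e + 1) - (Finset.univ.filter (fun l => (μ l : ℕ) ≠ 0)).card})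
              (U : {Z : Finset {x : Fin k // (μ x : ℕ) = 0} //
                Z.card = (j + ∑ i, (μ i : ℕ)) / (e + 1) - (Finset.univ.filter (fun l => (μ l : ℕ) ≠ 0)).card + c}) =>
              if T.1 ⊆ U.1 then (1 : K) else 0)).rank
        else 0) := by
  have hiff : ∀ w : Fin k → Fin (e + 2), ((fun l => (⟨(w l : ℕ) % (e + 1), Nat.mod_lt _ (Nat.succ_pos e)⟩ : Fin (e + 1))) = μ) ↔
      ∀ l, (w l : ℕ) % (e + 1) = (μ l : ℕ) := fun w =>
    ⟨fun h l => Fin.ext_iff.mp (congrFun h l), fun h => funext fun l => Fin.ext (h l)⟩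
  have key : (Matrix.of fun (r : {r : {v : Fin k → Fin (e + 2) // (∑ i, (v i : ℕ)) + j = k * (e + 1)} //
          (fun l => (⟨(r.1 l : ℕ) % (e + 1), Nat.mod_lt _ (Nat.succ_pos e)⟩ : Fin (e + 1))) = μ})
        (q : {q : {m : Fin k → Fin (e + 2) // (∑ i, (m i : ℕ)) + (j + c * (e + 1)) = k * (e + 1)} //
          (fun l => (⟨(q.1 l : ℕ) % (e + 1), Nat.mod_lt _ (Nat.succ_pos e)⟩ : Fin (e + 1))) = μ}) =>
      ((((List.flatMap (colR (e + 3)))^[c] [List.ofFn (fun i => (q.1.1 i : ℕ))]).count (List.ofFn (fun i => (r.1.1 i : ℕ))) : ℕ) : K)) =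
      Matrix.reindex
        (Equiv.subtypeEquivRight (fun (r : {v : Fin k → Fin (e + 2) // (∑ i, (v i : ℕ)) + j = k * (e + 1)}) => hiff r.1)).symm
        (Equiv.subtypeEquivRight
          (fun (q : {m : Fin k → Fin (e + 2) // (∑ i, (m i : ℕ)) + (j + c * (e + 1)) = k * (e + 1)}) => hiff q.1)).symm
        (Matrix.of fun (r : {r : {v : Fin k → Fin (e + 2) // (∑ i, (v i : ℕ)) + j = k * (e + 1)} //
            ∀ l, (r.1 l : ℕ) % (e + 1) = (μ l : ℕ)})
          (q : {q : {m : Fin k → Fin (e + 2) // (∑ i, (m i : ℕ)) + (j + c * (e + 1)) = k * (e + 1)} //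
            ∀ l, (q.1 l : ℕ) % (e + 1) = (μ l : ℕ)}) =>
          ((((List.flatMap (colR (e + 3)))^[c] [List.ofFn (fun i => (q.1.1 i : ℕ))]).count
            (List.ofFn (fun i => (r.1.1 i : ℕ))) : ℕ) : K)) := by
    ext r q
    simp only [Matrix.reindex_apply, Equiv.symm_symm, Matrix.submatrix_apply, Matrix.of_apply, Equiv.subtypeEquivRight_apply_coe]
  rw [key, Matrix.rank_reindex]
  by_cases h : (e + 1) ∣ (j + ∑ i, (μ i : ℕ)) ∧ (e + 1) * (Finset.univ.filter (fun l => (μ l : ℕ) ≠ 0)).card ≤ j + ∑ i, (μ i : ℕ)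
  · rw [if_pos h]
    obtain ⟨⟨a, ha⟩, hle⟩ := h
    rw [ha] at hle
    have has : (Finset.univ.filter (fun l => (μ l : ℕ) ≠ 0)).card ≤ a := Nat.le_of_mul_le_mul_left hle (Nat.succ_pos e)
    have ht : (j + ∑ i, (μ i : ℕ)) / (e + 1) - (Finset.univ.filter (fun l => (μ l : ℕ) ≠ 0)).card =
        a - (Finset.univ.filter (fun l => (μ l : ℕ) ≠ 0)).card := by rw [ha, Nat.mul_div_cancel_left a (Nat.succ_pos e)]
    rw [ht]
    exact rank_fiber_pow_eq K k e c j μ (a - (Finset.univ.filter (fun l => (μ l : ℕ) ≠ 0)).card) (by rw [Nat.sub_add_cancel has]; exact ha)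
  · rw [if_neg h]
    exact rank_fiber_pow_zero K k e c j μ h

/-- **(LW) THEOREM L over an arbitrary field, reduced form**: `rank (×q^c : B_{k(e+1)−j−c(e+1)} → B_{k(e+1)−j})`
`= Σ_μ [e+1 ∣ σ ∧ (e+1)s ≤ σ] · rank_K (c! • W_{t,t+c}({x // μ x = 0}))`, `t = σ/(e+1) − s` — every `K`, `d = e + 3 ≥ 3`, `c`, `j`. -/
theorem rank_mulDeltaPow_levels_eq_sum (K : Type*) [Field K] (k e c j : ℕ) :
    (Matrix.of fun (v : {v : Fin k → Fin (e + 2) // (∑ i, (v i : ℕ)) + j = k * (e + 1)})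
        (m : {m : Fin k → Fin (e + 2) // (∑ i, (m i : ℕ)) + (j + c * (e + 1)) = k * (e + 1)}) =>
      ((((List.flatMap (colR (e + 3)))^[c] [List.ofFn (fun i => (m.1 i : ℕ))]).count (List.ofFn (fun i => (v.1 i : ℕ))) : ℕ) : K)).rank =
      ∑ μ : Fin k → Fin (e + 1),
        (if (e + 1) ∣ (j + ∑ i, (μ i : ℕ)) ∧ (e + 1) * (Finset.univ.filter (fun l => (μ l : ℕ) ≠ 0)).card ≤ j + ∑ i, (μ i : ℕ) then
            ((((c.factorial : ℕ) : K)) • Matrix.of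
              (fun (T : {Z : Finset {x : Fin k // (μ x : ℕ) = 0} //
                  Z.card = (j + ∑ i, (μ i : ℕ)) / (e + 1) - (Finset.univ.filter (fun l => (μ l : ℕ) ≠ 0)).card})
                (U : {Z : Finset {x : Fin k // (μ x : ℕ) = 0} //
                  Z.card = (j + ∑ i, (μ i : ℕ)) / (e + 1) - (Finset.univ.filter (fun l => (μ l : ℕ) ≠ 0)).card + c}) =>
                if T.1 ⊆ U.1 then (1 : K) else 0)).rank
          else 0) := by
  rw [rank_eq_sum_rank_fiber_of (K := K) (ι := Fin k → Fin (e + 1))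
    (fun (v : {v : Fin k → Fin (e + 2) // (∑ i, (v i : ℕ)) + j = k * (e + 1)})
        (m : {m : Fin k → Fin (e + 2) // (∑ i, (m i : ℕ)) + (j + c * (e + 1)) = k * (e + 1)}) =>
      ((((List.flatMap (colR (e + 3)))^[c] [List.ofFn (fun i => (m.1 i : ℕ))]).count (List.ofFn (fun i => (v.1 i : ℕ))) : ℕ) : K))
    (fun v l => (⟨(v.1 l : ℕ) % (e + 1), Nat.mod_lt _ (Nat.succ_pos e)⟩ : Fin (e + 1)))
    (fun m l => (⟨(m.1 l : ℕ) % (e + 1), Nat.mod_lt _ (Nat.succ_pos e)⟩ : Fin (e + 1)))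
    (fun v m hvm => by
      show ((((List.flatMap (colR (e + 3)))^[c] [List.ofFn (fun i => (m.1 i : ℕ))]).count
        (List.ofFn (fun i => (v.1 i : ℕ))) : ℕ) : K) = 0
      rw [count_iterate_colR c m.1 v.1, if_neg (fun h => hvm (funext fun l => Fin.ext (h.1 l))), Nat.cast_zero])]
  exact Finset.sum_congr rfl (fun μ _ => rank_block_pow_eq K k e c j μ)

/-- **(L≤) THEOREM L's value is a universal upper bound**: over any field the rank is at most
`Σ_μ [e+1 ∣ σ ∧ (e+1)s ≤ σ] · min (C(k−s,t), C(k−s,t+c))` (the blocks are `C(k−s,t) × C(k−s,t+c)`). -/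
theorem rank_mulDeltaPow_levels_le (K : Type*) [Field K] (k e c j : ℕ) :
    (Matrix.of fun (v : {v : Fin k → Fin (e + 2) // (∑ i, (v i : ℕ)) + j = k * (e + 1)})
        (m : {m : Fin k → Fin (e + 2) // (∑ i, (m i : ℕ)) + (j + c * (e + 1)) = k * (e + 1)}) =>
      ((((List.flatMap (colR (e + 3)))^[c] [List.ofFn (fun i => (m.1 i : ℕ))]).count (List.ofFn (fun i => (v.1 i : ℕ))) : ℕ) : K)).rank ≤
      ∑ μ : Fin k → Fin (e + 1),
        (if (e + 1) ∣ (j + ∑ i, (μ i : ℕ)) ∧ (e + 1) * (Finset.univ.filter (fun l => (μ l : ℕ) ≠ 0)).card ≤ j + ∑ i, (μ i : ℕ) then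
            min ((k - (Finset.univ.filter (fun l => (μ l : ℕ) ≠ 0)).card).choose
                  ((j + ∑ i, (μ i : ℕ)) / (e + 1) - (Finset.univ.filter (fun l => (μ l : ℕ) ≠ 0)).card))
              ((k - (Finset.univ.filter (fun l => (μ l : ℕ) ≠ 0)).card).choose
                  ((j + ∑ i, (μ i : ℕ)) / (e + 1) - (Finset.univ.filter (fun l => (μ l : ℕ) ≠ 0)).card + c))
          else 0) := by
  rw [rank_mulDeltaPow_levels_eq_sum K k e c j]
  refine Finset.sum_le_sum (fun μ _ => ?_)
  split_ifs with h
  · have hα : Fintype.card {x : Fin k // (μ x : ℕ) = 0} = k - (Finset.univ.filter (fun l => (μ l : ℕ) ≠ 0)).card := by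
      have h' := Finset.card_filter_add_card_filter_not (s := (Finset.univ : Finset (Fin k))) (fun l => (μ l : ℕ) = 0)
      rw [Fintype.card_subtype]
      simp only [Finset.card_univ, Fintype.card_fin, ne_eq] at h' ⊢
      omega
    refine le_min ((Matrix.rank_le_card_height _).trans_eq ?_) ((Matrix.rank_le_card_width _).trans_eq ?_)
    · rw [Fintype.card_finset_len, hα]
    · rw [Fintype.card_finset_len, hα]
  · exact le_rfl

/-- **(L0) VANISHING**: if `c! = 0` in `K` the matrix of `×q^c` is zero (each entry is `c!` or `0` by anchor 229's multiplicity identity). -/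
theorem mulDeltaPow_levels_eq_zero (K : Type*) [Field K] (k e c j : ℕ) (hc : ((c.factorial : ℕ) : K) = 0) :
    (Matrix.of fun (v : {v : Fin k → Fin (e + 2) // (∑ i, (v i : ℕ)) + j = k * (e + 1)})
        (m : {m : Fin k → Fin (e + 2) // (∑ i, (m i : ℕ)) + (j + c * (e + 1)) = k * (e + 1)}) =>
      ((((List.flatMap (colR (e + 3)))^[c] [List.ofFn (fun i => (m.1 i : ℕ))]).count (List.ofFn (fun i => (v.1 i : ℕ))) : ℕ) : K)) = 0 := by
  ext v m
  rw [Matrix.of_apply, Matrix.zero_apply, count_iterate_colR c m.1 v.1]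
  split_ifs
  · exact hc
  · exact Nat.cast_zero

/-- (L0), rank form: `c! = 0` in `K` ⇒ rank `0` … -/
theorem rank_mulDeltaPow_levels_eq_zero (K : Type*) [Field K] (k e c j : ℕ) (hc : ((c.factorial : ℕ) : K) = 0) :
    (Matrix.of fun (v : {v : Fin k → Fin (e + 2) // (∑ i, (v i : ℕ)) + j = k * (e + 1)})
        (m : {m : Fin k → Fin (e + 2) // (∑ i, (m i : ℕ)) + (j + c * (e + 1)) = k * (e + 1)}) =>
      ((((List.flatMap (colR (e + 3)))^[c] [List.ofFn (fun i => (m.1 i : ℕ))]).count (List.ofFn (fun i => (v.1 i : ℕ))) : ℕ) : K)).rank = 0 := by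
  rw [mulDeltaPow_levels_eq_zero K k e c j hc, Matrix.rank_zero]

/-- … in particular in characteristic `p ≤ c` (`p ∣ c!`): every unit column `×q^c` with `c ≥ p` vanishes identically. -/
theorem rank_mulDeltaPow_levels_eq_zero_of_charP (K : Type*) [Field K] (p : ℕ) [CharP K p] (hp : p.Prime) (k e c j : ℕ) (hpc : p ≤ c) :
    (Matrix.of fun (v : {v : Fin k → Fin (e + 2) // (∑ i, (v i : ℕ)) + j = k * (e + 1)})
        (m : {m : Fin k → Fin (e + 2) // (∑ i, (m i : ℕ)) + (j + c * (e + 1)) = k * (e + 1)}) =>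
      ((((List.flatMap (colR (e + 3)))^[c] [List.ofFn (fun i => (m.1 i : ℕ))]).count (List.ofFn (fun i => (v.1 i : ℕ))) : ℕ) : K)).rank = 0 :=
  rank_mulDeltaPow_levels_eq_zero K k e c j ((CharP.cast_eq_zero_iff K p _).mpr (hp.dvd_factorial.mpr hpc))

/-! ## Characteristic 2, `c = 1`: the complete answer at every level -/

/-- anchor 222's indicator matrix of `×q` IS anchor 229's multiplicity matrix at `c = 1`, up to the column reindexing `j + (e+1) = j + 1·(e+1)`
(anchor 174's `indicator_eq_count_colR`). -/
theorem mulDelta_levels_eq_reindex (K : Type*) [Field K] (k e j : ℕ) :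
    (Matrix.of fun (v : {v : Fin k → Fin (e + 2) // (∑ i, (v i : ℕ)) + j = k * (e + 1)})
        (m : {m : Fin k → Fin (e + 2) // (∑ i, (m i : ℕ)) + (j + (e + 1)) = k * (e + 1)}) =>
      if List.ofFn (fun i => (v.1 i : ℕ)) ∈ colR (e + 3) (List.ofFn (fun i => (m.1 i : ℕ))) then (1 : K) else 0) =
      Matrix.reindex (Equiv.refl _)
        (Equiv.subtypeEquivRight (fun (m : Fin k → Fin (e + 2)) =>
          (by rw [one_mul] : (∑ i, (m i : ℕ)) + (j + 1 * (e + 1)) = k * (e + 1) ↔ (∑ i, (m i : ℕ)) + (j + (e + 1)) = k * (e + 1))))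
        (Matrix.of fun (v : {v : Fin k → Fin (e + 2) // (∑ i, (v i : ℕ)) + j = k * (e + 1)})
            (m : {m : Fin k → Fin (e + 2) // (∑ i, (m i : ℕ)) + (j + 1 * (e + 1)) = k * (e + 1)}) =>
          ((((List.flatMap (colR (e + 3)))^[1] [List.ofFn (fun i => (m.1 i : ℕ))]).count (List.ofFn (fun i => (v.1 i : ℕ))) : ℕ) : K)) := by
  ext v m
  simp only [Matrix.reindex_apply, Matrix.submatrix_apply, Matrix.of_apply, Equiv.refl_symm, Equiv.coe_refl, id,
    Equiv.subtypeEquivRight_symm_apply_coe, Function.iterate_one, List.flatMap_singleton]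
  exact indicator_eq_count_colR K (e + 3) (by omega) _ _

/-- **(L2) THEOREM L at `c = 1` in CHARACTERISTIC 2, every `d = e + 3 ≥ 3`, every level** (anchor 222's matrix, `(2 : K) = 0`):
`rank (×q : B_{k(e+1)−j−(e+1)} → B_{k(e+1)−j}) = Σ_μ [e+1 ∣ σ ∧ (e+1)s ≤ σ ∧ s < k] · C(k−s−1, σ/(e+1)−s)` — versus
`min (C(k−s,t), C(k−s,t+1))` per block in characteristic `0` (anchor 222). -/
theorem rank_mulDelta_levels_of_two_eq_zero (K : Type*) [Field K] (h2 : (2 : K) = 0) (k e j : ℕ) :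
    (Matrix.of fun (v : {v : Fin k → Fin (e + 2) // (∑ i, (v i : ℕ)) + j = k * (e + 1)})
        (m : {m : Fin k → Fin (e + 2) // (∑ i, (m i : ℕ)) + (j + (e + 1)) = k * (e + 1)}) =>
      if List.ofFn (fun i => (v.1 i : ℕ)) ∈ colR (e + 3) (List.ofFn (fun i => (m.1 i : ℕ))) then (1 : K) else 0).rank =
      ∑ μ : Fin k → Fin (e + 1),
        (if (e + 1) ∣ (j + ∑ i, (μ i : ℕ)) ∧ (e + 1) * (Finset.univ.filter (fun l => (μ l : ℕ) ≠ 0)).card ≤ j + ∑ i, (μ i : ℕ) ∧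
            (Finset.univ.filter (fun l => (μ l : ℕ) ≠ 0)).card < k then
          (k - (Finset.univ.filter (fun l => (μ l : ℕ) ≠ 0)).card - 1).choose
            ((j + ∑ i, (μ i : ℕ)) / (e + 1) - (Finset.univ.filter (fun l => (μ l : ℕ) ≠ 0)).card)
        else 0) := by
  rw [mulDelta_levels_eq_reindex K k e j, Matrix.rank_reindex, rank_mulDeltaPow_levels_eq_sum K k e 1 j]
  refine Finset.sum_congr rfl (fun μ _ => ?_)
  have hα : Fintype.card {x : Fin k // (μ x : ℕ) = 0} = k - (Finset.univ.filter (fun l => (μ l : ℕ) ≠ 0)).card := by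
    have h' := Finset.card_filter_add_card_filter_not (s := (Finset.univ : Finset (Fin k))) (fun l => (μ l : ℕ) = 0)
    rw [Fintype.card_subtype]
    simp only [Finset.card_univ, Fintype.card_fin, ne_eq] at h' ⊢
    omega
  have hsk : (Finset.univ.filter (fun l => (μ l : ℕ) ≠ 0)).card ≤ k :=
    (Finset.card_filter_le _ _).trans_eq (by rw [Finset.card_univ, Fintype.card_fin])
  by_cases h : (e + 1) ∣ (j + ∑ i, (μ i : ℕ)) ∧ (e + 1) * (Finset.univ.filter (fun l => (μ l : ℕ) ≠ 0)).card ≤ j + ∑ i, (μ i : ℕ)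
  · rw [if_pos h, Nat.factorial_one, Nat.cast_one, one_smul]
    by_cases hs : (Finset.univ.filter (fun l => (μ l : ℕ) ≠ 0)).card < k
    · rw [if_pos ⟨h.1, h.2, hs⟩]
      haveI : Nonempty {x : Fin k // (μ x : ℕ) = 0} := Fintype.card_pos_iff.mp (by rw [hα]; omega)
      rw [rank_incl_one_of_two_eq_zero K h2, hα]
    · rw [if_neg (fun h' => hs h'.2.2)]
      refine le_antisymm ((Matrix.rank_le_card_width _).trans_eq ?_) (Nat.zero_le _)
      rw [Fintype.card_finset_len, hα, show k - (Finset.univ.filter (fun l => (μ l : ℕ) ≠ 0)).card = 0 by omega, Nat.choose_zero_succ]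
  · rw [if_neg h, if_neg (fun h' => h ⟨h'.1, h'.2.1⟩)]

end Summit.HodgeConjecture.HodgeConjecture.HodgeLocus.Census.UnitColumnRankLevelsChar
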